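import Literature.Analysis.FluidPDE.AxisymmetricL3OffAxis
import Literature.Analysis.FluidPDE.AxisymmetricL3Infinity
import Literature.Analysis.FluidPDE.AncientMildWeakStar
import HarnessLib

/-!
# The one-sided radial gate is inherited by every sup-zoom limit of a hypothetical singularity

Helper toward the crux `OneSidedRadialCriterion` (stmt-NavierStokesRegularity-19059, route
TypeIIInviscidRelaxation; registered line `subcritical_core_reynolds`, stub `stub_subcriticalCoreReynolds` ⟺ crux by
name, `SubcriticalCoreReynolds.oneSidedRadialCriterion_iff_subcriticalCoreReynolds`).  The open half of the crux is
`C ≥ 2`; every comparison input (static or time-dependent barrier for the swirl equation with a one-sided drift bound)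
is certified EMPTY there (`RadialInflowBarrierWall.not_isTubeBarrier_of_two_le`,
`RadialInflowBarrierWallT.not_exists_halfLineBarrier_oneSided`), so an attack must use the Navier–Stokes dynamics.
The census of hand 5-g0 (evidence `CENSUS-19059-hand5g0-v2.md` on the item) lists as UNTRIED angle (ii): "rescaling at
the Type-II scale → ancient solution … as a Liouville target WITH the gate".  This file supplies the kernel form of that
angle for ANY sup-zoom (in particular for the tree's `CompactAmplification.zoom_dichotomy_of_isMaximalSmoothSolution`,
KNSS 2009 §6, whose output — meridional near-max points `(tₙ, xₙ)`, levels `Mₙ = ‖u(tₙ,xₙ)‖ → ∞`, zoom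
`Mₙ⁻¹ u(tₙ + Mₙ⁻² s, xₙ + Mₙ⁻¹ y) → W(s,y)` — is exactly the hypothesis list used below, with pointwise convergence only).

**What is proved** (any viscosity `ν > 0`; the crux's standing hypotheses verbatim):

* `tendsto_top_of_levels` — times `tₙ < T` carrying unbounded levels `‖u(tₙ,xₙ)‖ → ∞` tend to `T` (sub-slab bound);
* `cylRadius_tendsto_zero_of_levels` — such points go TO THE AXIS: `cylRadius xₙ → 0`.  Inputs: the far field is
  bounded near the top (`axisymmetricL3_boundedNearTop_infinity`: CKN ε-regularity on far cylinders) and every off-axis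
  point is regular at the lifespan (`axisymmetricL3_boundedNearTop_offAxis`, Seregin–Šverák 2009 §3), plus
  Bolzano–Weierstrass; no Type-I hypothesis, no gate;
* `zoomGate_of_tendsto` — THE CONTENT: under the gate `x₀u₀ + x₁u₁ ≥ -Cν` on `{cylRadius < δ} × [0,T)`, for meridional
  points `xₙ` (`xₙ,₁ = 0 ≤ xₙ,₀`), levels `Mₙ → ∞` and ANY pointwise limit `W` of the zoom on the negative slices, along a
  subsequence the rescaled axis offsets `aₙ = Mₙ · cylRadius xₙ` converge in `[0, ∞]` and the gate passes to the limit as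
  a GLOBAL one-sided constraint (the tube `{r < δ}` becomes all of space, `δMₙ → ∞`; `r u_r` is scale invariant:
  `(xₙ + Mₙ⁻¹y)·u = (aₙ + y₀)V₀ + y₁V₁` for the zoom `V`):
  - `aₙ → a < ∞`:  `(a + y₀) W₀(s,y) + y₁ W₁(s,y) ≥ -Cν` for all `s < 0`, `y` — the gate about the axis through `-a e₀`;
  - `aₙ → ∞`:  `W₀(s,y) ≥ 0` for all `s < 0`, `y` — no component towards the (infinitely far) axis at all;
* `zoomGate_constant_branch`, `unit_constant_axial` — in a CONSTANT limit `W ≡ b` the inherited gate pins `b₀ = b₁ = 0`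
  (so a unit constant is the axial drift `±e_z`) when `a < ∞`, and `b₀ ≥ 0` when `a = ∞`.

Reading for the line.  Composed with the tree's zoom dichotomy (`ν = 1`: the limit is EITHER a unit constant OR has an
axisymmetric swirling translate with `|Γ| ≤ sup|Γ(u₀)|`), a `C ≥ 2` singularity seen at the Kolmogorov scale around its
velocity maxima is either (i) a unit axial jet `±e_z` within `O(Mₙ⁻¹·a)` of the axis / a uniform drift with non-negative
offset component, or (ii) a bounded ancient mild axisymmetric SWIRLING flow obeying the global sink bound
`(a + y₀)W₀ + y₁W₁ ≥ -C`, or its `a = ∞` shadow `W₀ ≥ 0`.  Branch (i) is NOT contradictory (KNSS's Type-II caveat: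
constants survive the sup-zoom), so no Liouville theorem for (ii) alone closes the crux through this zoom; (ii) is the
precise ONE-SIDED Liouville problem in which the number `2` must reappear if the crux holds for every `C`.
Nothing here proves `OneSidedRadialCriterion`, `AxisymSwirlRegular` or NavierStokesRegularity.

References: H. Koch, N. Nadirashvili, G. Seregin, V. Šverák, Acta Math. 203 (2009) = arXiv:0709.3599, §4, §6
[KochNadirashviliSereginSverak2009]; G. Seregin, V. Šverák, Comm. PDE 34 (2009) = arXiv:0804.1803, §3
[SereginSverak2009]; L. Caffarelli, R. Kohn, L. Nirenberg, CPAM 35 (1982) [CaffarelliKohnNirenberg1982].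
-/

set_option linter.dupNamespace false

noncomputable section

open Set Function Filter Topology Metric

namespace Summit.NavierStokesRegularity.NavierStokesRegularity.Theorems.OneSidedZoomGate

open Literature.Analysis Literature.Analysis.FluidPDE

/-! ## §1 Small tools -/

/-- Evaluation at a coordinate is continuous on `ℝ³`. [folklore] -/
theorem continuous_apply_coord (i : Fin 3) : Continuous fun v : (EuclideanSpace ℝ (Fin 3)) => v i :=
  PiLp.continuous_apply 2 _ i

/-- For a meridional point `x` (`x₁ = 0`, `x₀ ≥ 0`) the distance to the axis is `x₀`. [folklore] -/
theorem cylRadius_of_meridional {x : (EuclideanSpace ℝ (Fin 3))} (h1 : x 1 = 0) (h0 : 0 ≤ x 0) : cylRadius x = x 0 := by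
  rw [cylRadius, h1]
  simp only [ne_eq, OfNat.ofNat_ne_zero, not_false_eq_true, zero_pow, add_zero]
  exact Real.sqrt_sq h0

/-- A nonnegative real sequence with no upper bound exceeds every level frequently. [folklore] -/
theorem frequently_le_of_not_bddAbove {a : ℕ → ℝ} (ha : ¬ BddAbove (Set.range a)) (h0 : ∀ n, 0 ≤ a n) (k : ℝ) :
    ∃ᶠ n in atTop, k ≤ a n := by
  by_contra hcon
  rw [Filter.not_frequently] at hcon
  obtain ⟨N, hN⟩ := eventually_atTop.1 hcon
  apply ha
  refine ⟨max k (∑ m ∈ Finset.range N, a m), ?_⟩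
  rintro _ ⟨n, rfl⟩
  by_cases hn : n < N
  · have h : a n ≤ ∑ m ∈ Finset.range N, a m :=
      Finset.single_le_sum (fun m _ => h0 m) (Finset.mem_range.2 hn)
    exact h.trans (le_max_right _ _)
  · push Not at hn
    have h := hN n hn
    push Not at h
    exact h.le.trans (le_max_left _ _)

/-- A nonnegative real sequence has a subsequence converging in `[0, ∞]`: to some `a ≥ 0`, or to `+∞`. [folklore] -/
theorem exists_subseq_tendsto_or_atTop {A : ℕ → ℝ} (hA0 : ∀ n, 0 ≤ A n) :
    ∃ φ : ℕ → ℕ, StrictMono φ ∧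
      ((∃ a : ℝ, 0 ≤ a ∧ Tendsto (A ∘ φ) atTop (𝓝 a)) ∨ Tendsto (A ∘ φ) atTop atTop) := by
  by_cases hbA : BddAbove (Set.range A)
  · obtain ⟨Amax, hAmax⟩ := hbA
    have hmem : ∀ n, A n ∈ Icc 0 Amax := fun n => ⟨hA0 n, hAmax ⟨n, rfl⟩⟩
    obtain ⟨a, ha, φ, hφ, hlim⟩ := tendsto_subseq_of_bounded (Metric.isBounded_Icc 0 Amax) hmem
    rw [closure_Icc] at ha
    exact ⟨φ, hφ, Or.inl ⟨a, ha.1, hlim⟩⟩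
  · have hfreq := frequently_le_of_not_bddAbove hbA hA0
    obtain ⟨φ, hφ, hφP⟩ := extraction_forall_of_frequently (P := fun k n => (k : ℝ) ≤ A n)
      fun k => hfreq k
    refine ⟨φ, hφ, Or.inr ?_⟩
    exact tendsto_atTop_mono (fun k => hφP k) tendsto_natCast_atTop_atTop

/-! ## §2 Unbounded levels: the times go to `T`, the points go to the axis -/

/-- **Times carrying unbounded levels tend to the final time.**  If `u` is bounded on every closed sub-slab
`[0,T'] × ℝ³`, `T' < T`, then times `tₙ ∈ (0,T)` with `‖u(tₙ,xₙ)‖ → ∞` satisfy `tₙ → T`. [folklore] -/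
theorem tendsto_top_of_levels {T : ℝ} {u : ℝ → (EuclideanSpace ℝ (Fin 3)) → (EuclideanSpace ℝ (Fin 3))}
    (hbd : ∀ T' < T, ∃ M : ℝ, ∀ t ∈ Icc 0 T', ∀ x, ‖u t x‖ ≤ M)
    {t : ℕ → ℝ} {x : ℕ → (EuclideanSpace ℝ (Fin 3))} (ht : ∀ n, t n ∈ Ioo 0 T)
    (hM : Tendsto (fun n => ‖u (t n) (x n)‖) atTop atTop) : Tendsto t atTop (𝓝 T) := by
  rw [tendsto_order]
  refine ⟨fun T' hT' => ?_, fun T' hT' => Eventually.of_forall fun n => (ht n).2.trans hT'⟩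
  obtain ⟨B, hB⟩ := hbd T' hT'
  filter_upwards [hM.eventually_gt_atTop B] with n hn
  by_contra hle
  push Not at hle
  have hle' : ‖u (t n) (x n)‖ ≤ B := hB (t n) ⟨(ht n).1.le, hle⟩ (x n)
  exact absurd hle' (not_le.2 hn)

/-- **Points carrying unbounded levels go to the axis** (standing class, any `ν > 0`; no Type-I hypothesis, no
gate).  For a classical solution on `[0,T)` which is Leray–Hopf, bounded on closed sub-slabs and axisymmetric, points
`(tₙ, xₙ)`, `tₙ ∈ (0,T)`, with `‖u(tₙ,xₙ)‖ → ∞` satisfy `cylRadius xₙ → 0`.  Far field: `axisymmetricL3_boundedNearTop_infinity`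
(CKN ε-regularity on far cylinders); off-axis points are regular at the lifespan: `axisymmetricL3_boundedNearTop_offAxis`
(Seregin–Šverák 2009 §3); Bolzano–Weierstrass in the slab `{ε ≤ cylRadius} ∩ B̄(0,R)`.
[cite: SereginSverak2009, §3 (arXiv p. 9); CaffarelliKohnNirenberg1982, Prop. 1] -/
theorem cylRadius_tendsto_zero_of_levels {ν T : ℝ} (hν : 0 < ν) (hT : 0 < T)
    {u : ℝ → (EuclideanSpace ℝ (Fin 3)) → (EuclideanSpace ℝ (Fin 3))} {p : ℝ → (EuclideanSpace ℝ (Fin 3)) → ℝ}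
    (hcl : IsClassicalNSSolutionOn (Ico 0 T) ν 0 u p) (hLH : IsLerayHopfOn T ν 0 (u 0) u)
    (hbd : ∀ T' < T, ∃ M : ℝ, ∀ t ∈ Icc 0 T', ∀ x, ‖u t x‖ ≤ M)
    (hax : ∀ t ∈ Ico 0 T, IsAxisymmetric (u t))
    {t : ℕ → ℝ} {x : ℕ → (EuclideanSpace ℝ (Fin 3))} (ht : ∀ n, t n ∈ Ioo 0 T)
    (hM : Tendsto (fun n => ‖u (t n) (x n)‖) atTop atTop) :
    Tendsto (fun n => cylRadius (x n)) atTop (𝓝 0) := by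
  have htT := tendsto_top_of_levels hbd ht hM
  have H : AxisymmetricL3Hyp ν T u p := ⟨hν, hT, hcl, hLH, hbd, hax⟩
  -- far field: eventually `‖xₙ‖ < R`
  obtain ⟨R, r, K, hr, hfar⟩ := axisymmetricL3_boundedNearTop_infinity H
  have hxR : ∀ᶠ n in atTop, ‖x n‖ < R := by
    have h1 : ∀ᶠ n in atTop, T - r ^ 2 < t n := (tendsto_order.1 htT).1 _ (by nlinarith [pow_pos hr 2])
    filter_upwards [h1, hM.eventually_gt_atTop K] with n hn hK
    by_contra hle
    push Not at hle
    have hle' : ‖u (t n) (x n)‖ ≤ K := hfar (t n) ⟨hn, (ht n).2⟩ (x n) hle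
    exact absurd hle' (not_le.2 hK)
  rw [tendsto_order]
  refine ⟨fun ε hε => Eventually.of_forall fun n => hε.trans_le (cylRadius_nonneg _), fun ε hε => ?_⟩
  by_contra hcon
  rw [Filter.not_eventually] at hcon
  -- frequently in the compact slab `S = {ε ≤ cylRadius} ∩ closedBall 0 R`
  set S : Set (EuclideanSpace ℝ (Fin 3)) := {z | ε ≤ cylRadius z} ∩ closedBall 0 R with hS_def
  have hSbdd : Bornology.IsBounded S := isBounded_closedBall.subset inter_subset_right
  have hScl : IsClosed S :=
    (isClosed_le continuous_const continuous_cylRadius).inter isClosed_closedBall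
  have hfreq : ∃ᶠ n in atTop, x n ∈ S := by
    refine (hcon.and_eventually hxR).mono fun n hn => ⟨?_, ?_⟩
    · exact not_lt.1 hn.1
    · exact mem_closedBall_zero_iff.2 hn.2.le
  obtain ⟨a, haS, φ, hφ, hxa⟩ := tendsto_subseq_of_frequently_bounded hSbdd hfreq
  rw [hScl.closure_eq] at haS
  have ha0 : cylRadius a ≠ 0 := ne_of_gt (lt_of_lt_of_le hε haS.1)
  -- the off-axis point `a` is regular at the lifespan: contradiction with the levels along `φ`
  obtain ⟨ρ, hρ, K₂, hK₂⟩ := axisymmetricL3_boundedNearTop_offAxis H a ha0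
  have h1 : ∀ᶠ k in atTop, T - ρ ^ 2 < t (φ k) :=
    (tendsto_order.1 (htT.comp hφ.tendsto_atTop)).1 _ (by nlinarith [pow_pos hρ 2])
  have h2 : ∀ᶠ k in atTop, x (φ k) ∈ ball a ρ := hxa (ball_mem_nhds a hρ)
  have h3 : ∀ᶠ k in atTop, K₂ < ‖u (t (φ k)) (x (φ k))‖ :=
    (hM.comp hφ.tendsto_atTop).eventually_gt_atTop K₂
  obtain ⟨k, ⟨hk1, hk2⟩, hk3⟩ := ((h1.and h2).and h3).exists
  have hle : ‖u (t (φ k)) (x (φ k))‖ ≤ K₂ := hK₂ (t (φ k)) ⟨hk1, (ht (φ k)).2⟩ (x (φ k)) hk2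
  exact absurd hle (not_le.2 hk3)

/-! ## §3 The gate is inherited by every sup-zoom limit -/

/-- **Gate inheritance by the sup-zoom** (any `ν > 0`).  Standing class of the crux (classical on `[0,T)`, Leray–Hopf,
bounded on closed sub-slabs, axisymmetric slices) with the gate `x₀u₀ + x₁u₁ ≥ -Cν` on `{cylRadius < δ} × [0,T)`;
meridional points `xₙ` (`xₙ,₁ = 0 ≤ xₙ,₀`), times `tₙ ∈ (0,T)`, levels `Mₙ = ‖u(tₙ,xₙ)‖ → ∞`, and a pointwise limit
`W` of the zoom `Mₙ⁻¹ u(tₙ + Mₙ⁻² s, xₙ + Mₙ⁻¹ y)` on every slice `s < 0`.  Then along a subsequence `φ` the rescaled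
axis offsets `Mₙ · cylRadius xₙ` EITHER converge to some `a ≥ 0`, and then `(a + y₀) W₀(s,y) + y₁ W₁(s,y) ≥ -Cν` for
all `s < 0`, `y` (the gate about the axis through `-a e₀`, on all of space-time), OR tend to `∞`, and then
`W₀(s,y) ≥ 0` for all `s < 0`, `y`.  Proof: `cylRadius xₙ → 0` and `tₙ → T` (§2) put the zoomed point in the tube
and the zoomed time in `[0,T)` eventually; scale invariance `(xₙ + Mₙ⁻¹y)·u = (aₙ + y₀)V₀ + y₁V₁`; limits.
[cite: KochNadirashviliSereginSverak2009, §6 (sup-zoom); SereginSverak2009, §3] -/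
theorem zoomGate_of_tendsto {ν T C δ : ℝ} (hν : 0 < ν) (hT : 0 < T) (hδ : 0 < δ)
    {u : ℝ → (EuclideanSpace ℝ (Fin 3)) → (EuclideanSpace ℝ (Fin 3))} {p : ℝ → (EuclideanSpace ℝ (Fin 3)) → ℝ}
    (hcl : IsClassicalNSSolutionOn (Ico 0 T) ν 0 u p) (hLH : IsLerayHopfOn T ν 0 (u 0) u)
    (hbd : ∀ T' < T, ∃ M : ℝ, ∀ t ∈ Icc 0 T', ∀ x, ‖u t x‖ ≤ M)
    (hax : ∀ t ∈ Ico 0 T, IsAxisymmetric (u t))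
    (hgate : ∀ t ∈ Ico 0 T, ∀ x : (EuclideanSpace ℝ (Fin 3)), cylRadius x < δ → -(C * ν) ≤ x 0 * u t x 0 + x 1 * u t x 1)
    {t : ℕ → ℝ} {x : ℕ → (EuclideanSpace ℝ (Fin 3))} (ht : ∀ n, t n ∈ Ioo 0 T) (hx : ∀ n, x n 1 = 0 ∧ 0 ≤ x n 0)
    (hM : Tendsto (fun n => ‖u (t n) (x n)‖) atTop atTop)
    {W : ℝ → (EuclideanSpace ℝ (Fin 3)) → (EuclideanSpace ℝ (Fin 3))}
    (hpt : ∀ s < 0, ∀ y : (EuclideanSpace ℝ (Fin 3)), Tendsto (fun n => ‖u (t n) (x n)‖⁻¹ •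
        u (t n + ‖u (t n) (x n)‖⁻¹ ^ 2 * s) (x n + ‖u (t n) (x n)‖⁻¹ • y)) atTop (𝓝 (W s y))) :
    ∃ φ : ℕ → ℕ, StrictMono φ ∧
      ((∃ a : ℝ, 0 ≤ a ∧ Tendsto (fun k => ‖u (t (φ k)) (x (φ k))‖ * cylRadius (x (φ k))) atTop (𝓝 a) ∧
          ∀ s < 0, ∀ y : (EuclideanSpace ℝ (Fin 3)), -(C * ν) ≤ (a + y 0) * W s y 0 + y 1 * W s y 1) ∨
        (Tendsto (fun k => ‖u (t (φ k)) (x (φ k))‖ * cylRadius (x (φ k))) atTop atTop ∧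
          ∀ s < 0, ∀ y : (EuclideanSpace ℝ (Fin 3)), 0 ≤ W s y 0)) := by
  have htT := tendsto_top_of_levels hbd ht hM
  have hr0 := cylRadius_tendsto_zero_of_levels hν hT hcl hLH hbd hax ht hM
  have hrad : ∀ n, cylRadius (x n) = x n 0 := fun n => cylRadius_of_meridional (hx n).1 (hx n).2
  -- the levels `M n` and the rescaled axis offsets `A n = M n · r n ≥ 0`
  set M : ℕ → ℝ := fun n => ‖u (t n) (x n)‖ with hM_def
  set A : ℕ → ℝ := fun n => M n * cylRadius (x n) with hA_def
  have hA0 : ∀ n, 0 ≤ A n := fun n => mul_nonneg (norm_nonneg _) (cylRadius_nonneg _)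
  obtain ⟨φ, hφ, hAlt⟩ := exists_subseq_tendsto_or_atTop hA0
  have hM0 : ∀ᶠ n in atTop, 0 < M n := hM.eventually_gt_atTop 0
  have hMinv : Tendsto (fun n => (M n)⁻¹) atTop (𝓝 0) := tendsto_inv_atTop_zero.comp hM
  -- ### the gate along the zoom: `(A n + y₀) V₀ + y₁ V₁ ≥ -Cν` eventually, for fixed `s < 0`, `y`
  have hgateV : ∀ s < 0, ∀ y : (EuclideanSpace ℝ (Fin 3)), ∀ᶠ n in atTop,
      -(C * ν) ≤ (A n + y 0) * ((M n)⁻¹ • u (t n + (M n)⁻¹ ^ 2 * s) (x n + (M n)⁻¹ • y)) 0 +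
        y 1 * ((M n)⁻¹ • u (t n + (M n)⁻¹ ^ 2 * s) (x n + (M n)⁻¹ • y)) 1 := by
    intro s hs y
    -- the zoomed time is eventually in `[0, T)` and the zoomed point eventually in the tube
    have h1 : ∀ᶠ n in atTop, T / 2 < t n := (tendsto_order.1 htT).1 _ (by linarith)
    have h2 : ∀ᶠ n in atTop, (M n)⁻¹ ^ 2 * |s| < T / 2 := by
      have h : Tendsto (fun n => (M n)⁻¹ ^ 2 * |s|) atTop (𝓝 (0 ^ 2 * |s|)) := (hMinv.pow 2).mul_const _
      rw [zero_pow two_ne_zero, zero_mul] at h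
      exact (tendsto_order.1 h).2 _ (by linarith)
    have h3 : ∀ᶠ n in atTop, cylRadius (x n) + (M n)⁻¹ * ‖y‖ < δ := by
      have h : Tendsto (fun n => cylRadius (x n) + (M n)⁻¹ * ‖y‖) atTop (𝓝 (0 + 0 * ‖y‖)) :=
        hr0.add (hMinv.mul_const _)
      rw [zero_mul, add_zero] at h
      exact (tendsto_order.1 h).2 _ hδ
    filter_upwards [h1, h2, h3, hM0] with n hn1 hn2 hn3 hMn
    set τ : ℝ := t n + (M n)⁻¹ ^ 2 * s with hτ_def
    set ξ : (EuclideanSpace ℝ (Fin 3)) := x n + (M n)⁻¹ • y with hξ_def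
    have hs' : (M n)⁻¹ ^ 2 * s = -((M n)⁻¹ ^ 2 * |s|) := by
      rw [abs_of_neg hs]; ring
    have hτI : τ ∈ Ico 0 T := by
      refine ⟨?_, ?_⟩
      · rw [hτ_def, hs']; linarith
      · rw [hτ_def, hs']
        have : 0 ≤ (M n)⁻¹ ^ 2 * |s| := by positivity
        linarith [(ht n).2]
    have hξδ : cylRadius ξ < δ := by
      have h := cylRadius_le_cylRadius_add_norm_sub (x n) ξ
      have e : ‖ξ - x n‖ = (M n)⁻¹ * ‖y‖ := by
        rw [hξ_def, add_sub_cancel_left, norm_smul, Real.norm_eq_abs, abs_of_pos (inv_pos.2 hMn)]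
      linarith
    have hg := hgate τ hτI ξ hξδ
    -- the algebra `ξ · u = (Mₙ xₙ,₀ + y₀) V₀ + y₁ V₁`
    have hMne : M n ≠ 0 := hMn.ne'
    have e0 : ξ 0 = x n 0 + (M n)⁻¹ * y 0 := by
      rw [hξ_def, PiLp.add_apply, PiLp.smul_apply, smul_eq_mul]
    have e1 : ξ 1 = (M n)⁻¹ * y 1 := by
      rw [hξ_def, PiLp.add_apply, PiLp.smul_apply, smul_eq_mul, (hx n).1, zero_add]
    have eV : ∀ i, ((M n)⁻¹ • u τ ξ) i = (M n)⁻¹ * u τ ξ i := fun i => by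
      rw [PiLp.smul_apply, smul_eq_mul]
    have hAn : A n = M n * x n 0 := by simp only [hA_def, hrad n]
    rw [eV 0, eV 1, hAn]
    have key : (M n * x n 0 + y 0) * ((M n)⁻¹ * u τ ξ 0) + y 1 * ((M n)⁻¹ * u τ ξ 1) =
        ξ 0 * u τ ξ 0 + ξ 1 * u τ ξ 1 := by
      rw [e0, e1]; field_simp
    rw [key]
    exact hg
  -- pointwise convergence of the zoom components
  have hptV : ∀ s < 0, ∀ y : (EuclideanSpace ℝ (Fin 3)), ∀ i : Fin 3, Tendsto
      (fun n => ((M n)⁻¹ • u (t n + (M n)⁻¹ ^ 2 * s) (x n + (M n)⁻¹ • y)) i) atTop (𝓝 (W s y i)) :=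
    fun s hs y i => ((continuous_apply_coord i).tendsto _).comp (hpt s hs y)
  -- ### the inherited gate along `φ`
  refine ⟨φ, hφ, ?_⟩
  rcases hAlt with ⟨a, ha0, hAa⟩ | hAinf
  · refine Or.inl ⟨a, ha0, hAa, fun s hs y => ?_⟩
    have hlim : Tendsto (fun k => (A (φ k) + y 0) *
          ((M (φ k))⁻¹ • u (t (φ k) + (M (φ k))⁻¹ ^ 2 * s) (x (φ k) + (M (φ k))⁻¹ • y)) 0 +
        y 1 * ((M (φ k))⁻¹ • u (t (φ k) + (M (φ k))⁻¹ ^ 2 * s) (x (φ k) + (M (φ k))⁻¹ • y)) 1)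
        atTop (𝓝 ((a + y 0) * W s y 0 + y 1 * W s y 1)) :=
      ((hAa.add_const _).mul ((hptV s hs y 0).comp hφ.tendsto_atTop)).add
        (((hptV s hs y 1).comp hφ.tendsto_atTop).const_mul _)
    exact ge_of_tendsto hlim (hφ.tendsto_atTop.eventually (hgateV s hs y))
  · refine Or.inr ⟨hAinf, fun s hs y => ?_⟩
    -- divide the gate by `A (φ k) → ∞`
    have hApos : ∀ᶠ k in atTop, 0 < A (φ k) := hAinf.eventually_gt_atTop 0
    have hAinv : Tendsto (fun k => (A (φ k))⁻¹) atTop (𝓝 0) := tendsto_inv_atTop_zero.comp hAinf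
    set V0 : ℕ → ℝ := fun k =>
      ((M (φ k))⁻¹ • u (t (φ k) + (M (φ k))⁻¹ ^ 2 * s) (x (φ k) + (M (φ k))⁻¹ • y)) 0 with hV0
    set V1 : ℕ → ℝ := fun k =>
      ((M (φ k))⁻¹ • u (t (φ k) + (M (φ k))⁻¹ ^ 2 * s) (x (φ k) + (M (φ k))⁻¹ • y)) 1 with hV1
    have hV0lim : Tendsto V0 atTop (𝓝 (W s y 0)) := (hptV s hs y 0).comp hφ.tendsto_atTop
    have hV1lim : Tendsto V1 atTop (𝓝 (W s y 1)) := (hptV s hs y 1).comp hφ.tendsto_atTop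
    have hlhs : Tendsto (fun k => -(C * ν) * (A (φ k))⁻¹) atTop (𝓝 (-(C * ν) * 0)) := hAinv.const_mul _
    have hrhs : Tendsto (fun k => (1 + y 0 * (A (φ k))⁻¹) * V0 k + y 1 * (A (φ k))⁻¹ * V1 k) atTop
        (𝓝 ((1 + y 0 * 0) * W s y 0 + y 1 * 0 * W s y 1)) :=
      (((hAinv.const_mul _).const_add _).mul hV0lim).add ((hAinv.const_mul _).mul hV1lim)
    simp only [mul_zero] at hlhs
    simp only [mul_zero, add_zero, one_mul, zero_mul] at hrhs
    refine le_of_tendsto_of_tendsto hlhs hrhs ?_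
    filter_upwards [hφ.tendsto_atTop.eventually (hgateV s hs y), hApos] with k hk hAk
    have hAne : A (φ k) ≠ 0 := hAk.ne'
    have e : (1 + y 0 * (A (φ k))⁻¹) * V0 k + y 1 * (A (φ k))⁻¹ * V1 k =
        ((A (φ k) + y 0) * V0 k + y 1 * V1 k) * (A (φ k))⁻¹ := by
      field_simp
    rw [e]
    have hk' : -(C * ν) ≤ (A (φ k) + y 0) * V0 k + y 1 * V1 k := by simpa only [hV0, hV1] using hk
    exact mul_le_mul_of_nonneg_right hk' (inv_pos.2 hAk).le

/-! ## §4 The constant branch under the inherited gate -/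

/-- **The inherited gate pins a constant limit.**  If `W ≡ b` on `(-∞,0) × ℝ³` and the finite-offset gate
`(a + y₀) W₀ + y₁ W₁ ≥ -K` holds for all `y`, then `b₀ = 0` and `b₁ = 0` (test `y = -a e₀ - λ(b₀ e₀ + b₁ e₁)`,
`λ → ∞`); if the infinite-offset form `W₀ ≥ 0` holds then `b₀ ≥ 0`. [folklore] -/
theorem zoomGate_constant_branch {W : ℝ → (EuclideanSpace ℝ (Fin 3)) → (EuclideanSpace ℝ (Fin 3))} {b : (EuclideanSpace ℝ (Fin 3))} {K : ℝ} (hWb : ∀ s < 0, ∀ y, W s y = b) :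
    ((∃ a : ℝ, 0 ≤ a ∧ ∀ s < 0, ∀ y : (EuclideanSpace ℝ (Fin 3)), -K ≤ (a + y 0) * W s y 0 + y 1 * W s y 1) → b 0 = 0 ∧ b 1 = 0) ∧
    ((∀ s < 0, ∀ y : (EuclideanSpace ℝ (Fin 3)), 0 ≤ W s y 0) → 0 ≤ b 0) := by
  refine ⟨?_, fun h => ?_⟩
  · rintro ⟨a, -, hg⟩
    -- `λ (b₀² + b₁²) ≤ K` for every `λ ≥ 0`
    have key : ∀ lam : ℝ, 0 ≤ lam → lam * (b 0 ^ 2 + b 1 ^ 2) ≤ K := by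
      intro lam _hlam
      set y : (EuclideanSpace ℝ (Fin 3)) := EuclideanSpace.single 0 (-a - lam * b 0) + EuclideanSpace.single 1 (-(lam * b 1)) with hy
      have hy0 : y 0 = -a - lam * b 0 := by simp [hy]
      have hy1 : y 1 = -(lam * b 1) := by simp [hy]
      have h := hg (-1) (by norm_num) y
      rw [hWb (-1) (by norm_num), hy0, hy1] at h
      nlinarith
    have hsq : b 0 ^ 2 + b 1 ^ 2 ≤ 0 := by
      by_contra hpos
      push Not at hpos
      have h := key ((|K| + 1) / (b 0 ^ 2 + b 1 ^ 2)) (by positivity)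
      rw [div_mul_cancel₀ _ hpos.ne'] at h
      linarith [le_abs_self K]
    have h0 : b 0 ^ 2 = 0 := by nlinarith [sq_nonneg (b 0), sq_nonneg (b 1)]
    have h1 : b 1 ^ 2 = 0 := by nlinarith [sq_nonneg (b 0), sq_nonneg (b 1)]
    exact ⟨(pow_eq_zero_iff two_ne_zero).1 h0, (pow_eq_zero_iff two_ne_zero).1 h1⟩
  · have h1 := h (-1) (by norm_num) 0
    rwa [hWb (-1) (by norm_num)] at h1

/-- **A unit constant with vanishing horizontal components is the axial drift `±e_z`**: `‖b‖ = 1`, `b₀ = b₁ = 0`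
⇒ `b₂ = 1 ∨ b₂ = -1`. [folklore] -/
theorem unit_constant_axial {b : (EuclideanSpace ℝ (Fin 3))} (hb : ‖b‖ = 1) (h0 : b 0 = 0) (h1 : b 1 = 0) :
    b 2 = 1 ∨ b 2 = -1 := by
  have h : ‖b‖ ^ 2 = b 0 ^ 2 + b 1 ^ 2 + b 2 ^ 2 := by
    rw [EuclideanSpace.norm_eq, Real.sq_sqrt (Finset.sum_nonneg fun i _ => by positivity),
      Fin.sum_univ_three]
    simp only [Real.norm_eq_abs, sq_abs]
  rw [hb, h0, h1] at h
  have h2 : b 2 ^ 2 = 1 := by nlinarith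
  have h3 : (b 2 - 1) * (b 2 + 1) = 0 := by ring_nf; linarith
  rcases mul_eq_zero.1 h3 with h4 | h4
  · exact Or.inl (by linarith)
  · exact Or.inr (by linarith)

end Summit.NavierStokesRegularity.NavierStokesRegularity.Theorems.OneSidedZoomGate

end
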